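import Summits.CriticalPhenomena.PercolationContinuityZ3.Theorems.PercNearOneGluingNoHeavyLowerTailCubicThreePointTerminalClosure
import Mathlib.Tactic.Ring
import Mathlib.Tactic.Linarith
import Mathlib.Tactic.Positivity
import HarnessLib

/-!
# `NoHeavyLowerTail` (stmt-CriticalPhenomena-4575) — the 2-SUM of two three-terminal laws along one terminal and one Steiner vertex:
# `AG`, the sparse sheet `Hb` and the dense sheet `Ha` of the sharp cubic row are CLOSED (explicit integer certificates)

Support file (prover prim-gen-kcluster gen 28; `--supports stmt-CriticalPhenomena-4575`; memo run/shared/lean/prim/prim-gen-kcluster/KCLUSTER-gen28.md §6–§7).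
Pure algebra over a commutative ring / `ℝ`; no measure theory, no named facts, no sorries, no definitions.  Cell convention of
`…CubicThreePointTerminalClosure` (`AG q u₁ u₂ u₃ t`, `Ha`, `Hb` with `(q,u₁,u₂,u₃,t) = (P(a|b|c), P(ab|c), P(ac|b), P(bc|a), P(abc))`).

THE OPERATION.  Let `N₁` be a network containing the terminals `a, b` and a further vertex `s`, `N₂` a network containing `b, c` and `s`,
edge-disjoint and sharing exactly the two vertices `b` (a terminal) and `s` (a Steiner vertex of the result): the **2-sum**
`N = N₁ ∪_{b,s} N₂`.  Write `(T₁,A₁,B₁,V₁,Q₁)` for the three-point law of `(a,b,s)` in `N₁` (`T₁` all joined, `A₁` = `a` apart & `b~s`,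
`B₁` = `b` apart & `a~s`, `V₁` = `s` apart & `a~b`, `Q₁` all apart) and `(T₂,B₂,C₂,W₂,Q₂)` for that of `(b,c,s)` in `N₂` (`B₂` = `b` apart &
`c~s`, `C₂` = `c` apart & `b~s`, `W₂` = `s` apart & `b~c`).  By independence of the two edge sets the law of `(a,b,c)` in `N` is the
BILINEAR map (25-cell gluing table; `a ~ c` is possible only through `b` or through `s`)
  `q  = A₁C₂ + A₁Q₂ + B₁Q₂ + Q₁(B₂+C₂+Q₂)`,            `u₁ = P(ab|c) = T₁C₂ + T₁Q₂ + V₁(B₂+C₂+Q₂) + B₁C₂`,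
  `u₂ = P(ac|b) = B₁B₂`,                               `u₃ = P(bc|a) = A₁(T₂+W₂+B₂) + B₁W₂ + Q₁(T₂+W₂)`,
  `t  = (T₁+V₁)(T₂+W₂) + T₁B₂ + B₁T₂`                    (written out in every statement below; no definition is introduced).
It contains series composition through `b` (`s` isolated in one piece) and — composed with the pendant move `T_s` of
`…TerminalClosure` (an edge `v–s` of weight `y` hung inside `N₁`) — every "bridged series composition" `N₁(a,b) ∪_b N₂(b,c) + y·vw`;
by the gluing theorems of `…CubicThreePointSharpRowGluing` (join along the terminals, pendant arms) it therefore also covers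
{blob network + one cross edge} and {hub network + one chord} (KCLUSTER-gen28 §6), the two 'one-edge' perturbations of the tight loci
whose first-order theory is `…CubicThreePointLocusStability`.

THEOREMS (certificates found by linear programming over products of the generators, kit j112721 — exact: integer coefficients,
residual 0 — and re-checked here by `ring`):
* `AG_twoSum` / `AG_twoSum_nonneg`: `AG(N)` is a sum of 18 products of cells and `AG₁`, `AG₂` ⟹ `AG ≥ 0` is preserved (law level; for
  graphs this is Gladkov's theorem again).
* `Hb_twoSum_sparse` / `Hb_twoSum_sparse_nonneg`: if both pieces are SPARSE-type (`Q_i ≥ T_i`, `AG_i ≥ 0`, `Hb_i ≥ 0`) then `Hb(N) ≥ 0`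
  — 88 products of cells, `AG_i`, `Hb_i` and the margins `Q_i − T_i` (the margins are necessary: without them the LP is infeasible).
* `Ha_twoSum_dense` / `Ha_twoSum_dense_nonneg`: if both pieces are DENSE-type (`T_i ≥ Q_i`, `AG_i ≥ 0`, `Ha_i ≥ 0`) then `Ha(N) ≥ 0` (88 products).
* `maxH_twoSum_sameType_nonneg`: hence the K3 invariant `I = {cells ≥ 0, AG ≥ 0, max(Ha,Hb) ≥ 0}` is preserved by 2-sums of pieces of the SAME type.
OPEN (census-clean: 72,000 pseudo-law pairs in `I` incl. 60,000 next to its boundary, and 5,555 pairs of laws of random graphs, 0 violations;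
KCLUSTER-gen28 §6): the MIXED case (one sparse-type, one dense-type piece) — `max(Ha,Hb)(N) ≥ 0` holds in every test but neither sheet alone,
and no certificate exists in the present generator language (LP infeasible, also with the output-regime margin as a generator); compare the
K3-semigroup's mixed case `CubicThreePointJoin.Ha_join_dense_sparse`.  With the mixed case, `I` would be closed under 2-sums outright and a
minimal counterexample to SF3-Hmax would admit no `{terminal, Steiner vertex}` 2-separation (conjecture T7 of the memo).
[cite: Gladkov2024StrongFKG, Cor. 4.2 (the quadratic form AG)]; [cite: GladkovZimin2024HK, §4 (block decomposition along a separator)]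
-/

namespace Summit.CriticalPhenomena.PercolationContinuityZ3.Theorems

namespace CubicThreePointTwoSum

open CubicThreePointTerminal

section Identities

variable {R : Type*} [CommRing R]

/-- **`AG` under the 2-sum** (identity, any commutative ring; 18 products of cells and the two channel `AG`'s, all with coefficient `+1` —
found by LP over generator products, kit j112721): the Aas–Gladkov form of the 2-sum law is a nonnegative combination. [this work] -/
theorem AG_twoSum (T₁ A₁ B₁ V₁ Q₁ T₂ B₂ C₂ W₂ Q₂ : R) :
    AG (A₁ * C₂ + A₁ * Q₂ + B₁ * Q₂ + Q₁ * (B₂ + C₂ + Q₂))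
      (T₁ * C₂ + T₁ * Q₂ + V₁ * (B₂ + C₂ + Q₂) + B₁ * C₂) (B₁ * B₂)
      (A₁ * (T₂ + W₂ + B₂) + B₁ * W₂ + Q₁ * (T₂ + W₂)) ((T₁ + V₁) * (T₂ + W₂) + T₁ * B₂ + B₁ * T₂)
    = T₁ * B₁ * B₂ * W₂ + T₁ * B₁ * (AG Q₂ B₂ C₂ W₂ T₂) + A₁ * B₁ * B₂ * C₂ + A₁ * B₁ * B₂ * W₂ + A₁ * B₁ * B₂ * Q₂ + A₁ * B₁ * (AG Q₂ B₂ C₂ W₂ T₂)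
     + B₁ * B₁ * (AG Q₂ B₂ C₂ W₂ T₂) + B₁ * V₁ * T₂ * B₂ + B₁ * V₁ * B₂ * C₂ + B₁ * V₁ * B₂ * W₂ + B₁ * V₁ * (AG Q₂ B₂ C₂ W₂ T₂) + B₁ * Q₁ * B₂ * C₂
     + B₁ * Q₁ * (AG Q₂ B₂ C₂ W₂ T₂) + (AG Q₁ A₁ B₁ V₁ T₁) * T₂ * B₂ + (AG Q₁ A₁ B₁ V₁ T₁) * B₂ * B₂ + (AG Q₁ A₁ B₁ V₁ T₁) * B₂ * C₂
     + (AG Q₁ A₁ B₁ V₁ T₁) * B₂ * W₂ + (AG Q₁ A₁ B₁ V₁ T₁) * B₂ * Q₂ := by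
  simp only [AG]; ring

/-- **`Hb` under the 2-sum of two SPARSE-type laws** (identity, any commutative ring; 88 generator products with coefficients in {1,2}, kit
j112721/j112626): every summand is a product of cells, `AG₁`, `AG₂`, `Hb₁`, `Hb₂` and the sparse-regime margins `Q₁ − T₁`, `Q₂ − T₂`. [this work] -/
theorem Hb_twoSum_sparse (T₁ A₁ B₁ V₁ Q₁ T₂ B₂ C₂ W₂ Q₂ : R) :
    Hb (A₁ * C₂ + A₁ * Q₂ + B₁ * Q₂ + Q₁ * (B₂ + C₂ + Q₂))
      (T₁ * C₂ + T₁ * Q₂ + V₁ * (B₂ + C₂ + Q₂) + B₁ * C₂) (B₁ * B₂)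
      (A₁ * (T₂ + W₂ + B₂) + B₁ * W₂ + Q₁ * (T₂ + W₂)) ((T₁ + V₁) * (T₂ + W₂) + T₁ * B₂ + B₁ * T₂)
    = T₁ * A₁ * B₁ * (AG Q₂ B₂ C₂ W₂ T₂) * C₂ + T₁ * A₁ * B₁ * (AG Q₂ B₂ C₂ W₂ T₂) * Q₂ + T₁ * B₁ * B₁ * (Hb Q₂ B₂ C₂ W₂ T₂)
     + T₁ * B₁ * Q₁ * (AG Q₂ B₂ C₂ W₂ T₂) * C₂ + T₁ * B₁ * Q₁ * (Hb Q₂ B₂ C₂ W₂ T₂) + T₁ * B₁ * Q₁ * (Q₂ - T₂) * B₂ * C₂ + A₁ * A₁ * B₁ * B₂ * C₂ * C₂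
     + A₁ * A₁ * B₁ * B₂ * C₂ * W₂ + 2 * A₁ * A₁ * B₁ * B₂ * C₂ * Q₂ + A₁ * A₁ * B₁ * B₂ * W₂ * Q₂ + A₁ * A₁ * B₁ * B₂ * Q₂ * Q₂
     + A₁ * A₁ * B₁ * (AG Q₂ B₂ C₂ W₂ T₂) * C₂ + A₁ * A₁ * B₁ * (AG Q₂ B₂ C₂ W₂ T₂) * Q₂ + A₁ * B₁ * B₁ * B₂ * B₂ * W₂ + A₁ * B₁ * B₁ * B₂ * W₂ * Q₂
     + A₁ * B₁ * B₁ * (AG Q₂ B₂ C₂ W₂ T₂) * B₂ + A₁ * B₁ * B₁ * (AG Q₂ B₂ C₂ W₂ T₂) * C₂ + 2 * A₁ * B₁ * B₁ * (AG Q₂ B₂ C₂ W₂ T₂) * Q₂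
     + A₁ * B₁ * B₁ * (Q₂ - T₂) * B₂ * C₂ + A₁ * B₁ * B₁ * (Q₂ - T₂) * B₂ * Q₂ + A₁ * B₁ * V₁ * B₂ * C₂ * C₂ + A₁ * B₁ * V₁ * B₂ * C₂ * Q₂
     + A₁ * B₁ * V₁ * (AG Q₂ B₂ C₂ W₂ T₂) * C₂ + A₁ * B₁ * V₁ * (AG Q₂ B₂ C₂ W₂ T₂) * Q₂ + A₁ * B₁ * Q₁ * B₂ * B₂ * W₂
     + 2 * A₁ * B₁ * Q₁ * B₂ * C₂ * C₂ + A₁ * B₁ * Q₁ * B₂ * C₂ * W₂ + 2 * A₁ * B₁ * Q₁ * B₂ * C₂ * Q₂ + A₁ * B₁ * Q₁ * B₂ * W₂ * Q₂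
     + A₁ * B₁ * Q₁ * (AG Q₂ B₂ C₂ W₂ T₂) * B₂ + 2 * A₁ * B₁ * Q₁ * (AG Q₂ B₂ C₂ W₂ T₂) * C₂ + 2 * A₁ * B₁ * Q₁ * (AG Q₂ B₂ C₂ W₂ T₂) * Q₂
     + A₁ * B₁ * Q₁ * (Q₂ - T₂) * B₂ * C₂ + A₁ * B₁ * Q₁ * (Q₂ - T₂) * B₂ * Q₂ + B₁ * B₁ * B₁ * (Hb Q₂ B₂ C₂ W₂ T₂) + B₁ * B₁ * V₁ * B₂ * B₂ * C₂
     + B₁ * B₁ * V₁ * B₂ * C₂ * Q₂ + B₁ * B₁ * V₁ * (AG Q₂ B₂ C₂ W₂ T₂) * B₂ + B₁ * B₁ * V₁ * (AG Q₂ B₂ C₂ W₂ T₂) * Q₂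
     + B₁ * B₁ * Q₁ * (AG Q₂ B₂ C₂ W₂ T₂) * B₂ + B₁ * B₁ * Q₁ * (AG Q₂ B₂ C₂ W₂ T₂) * C₂ + B₁ * B₁ * Q₁ * (AG Q₂ B₂ C₂ W₂ T₂) * Q₂
     + B₁ * B₁ * Q₁ * (Hb Q₂ B₂ C₂ W₂ T₂) + B₁ * B₁ * Q₁ * (Q₂ - T₂) * B₂ * C₂ + B₁ * V₁ * Q₁ * B₂ * B₂ * C₂ + B₁ * V₁ * Q₁ * B₂ * C₂ * C₂
     + B₁ * V₁ * Q₁ * B₂ * C₂ * Q₂ + B₁ * V₁ * Q₁ * (AG Q₂ B₂ C₂ W₂ T₂) * B₂ + B₁ * V₁ * Q₁ * (AG Q₂ B₂ C₂ W₂ T₂) * C₂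
     + B₁ * V₁ * Q₁ * (AG Q₂ B₂ C₂ W₂ T₂) * Q₂ + B₁ * Q₁ * Q₁ * B₂ * C₂ * C₂ + B₁ * Q₁ * Q₁ * (AG Q₂ B₂ C₂ W₂ T₂) * B₂
     + B₁ * Q₁ * Q₁ * (AG Q₂ B₂ C₂ W₂ T₂) * C₂ + B₁ * Q₁ * Q₁ * (AG Q₂ B₂ C₂ W₂ T₂) * Q₂ + (AG Q₁ A₁ B₁ V₁ T₁) * A₁ * T₂ * B₂ * C₂
     + (AG Q₁ A₁ B₁ V₁ T₁) * A₁ * T₂ * B₂ * Q₂ + (AG Q₁ A₁ B₁ V₁ T₁) * A₁ * B₂ * B₂ * C₂ + (AG Q₁ A₁ B₁ V₁ T₁) * A₁ * B₂ * B₂ * Q₂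
     + (AG Q₁ A₁ B₁ V₁ T₁) * A₁ * B₂ * C₂ * C₂ + (AG Q₁ A₁ B₁ V₁ T₁) * A₁ * B₂ * C₂ * W₂ + 2 * (AG Q₁ A₁ B₁ V₁ T₁) * A₁ * B₂ * C₂ * Q₂
     + (AG Q₁ A₁ B₁ V₁ T₁) * A₁ * B₂ * W₂ * Q₂ + (AG Q₁ A₁ B₁ V₁ T₁) * A₁ * B₂ * Q₂ * Q₂ + (AG Q₁ A₁ B₁ V₁ T₁) * B₁ * T₂ * B₂ * Q₂
     + (AG Q₁ A₁ B₁ V₁ T₁) * B₁ * B₂ * B₂ * Q₂ + (AG Q₁ A₁ B₁ V₁ T₁) * B₁ * B₂ * C₂ * Q₂ + (AG Q₁ A₁ B₁ V₁ T₁) * B₁ * B₂ * W₂ * Q₂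
     + (AG Q₁ A₁ B₁ V₁ T₁) * B₁ * B₂ * Q₂ * Q₂ + (AG Q₁ A₁ B₁ V₁ T₁) * Q₁ * T₂ * B₂ * C₂ + (AG Q₁ A₁ B₁ V₁ T₁) * Q₁ * T₂ * B₂ * Q₂
     + (AG Q₁ A₁ B₁ V₁ T₁) * Q₁ * B₂ * B₂ * C₂ + (AG Q₁ A₁ B₁ V₁ T₁) * Q₁ * B₂ * B₂ * Q₂ + (AG Q₁ A₁ B₁ V₁ T₁) * Q₁ * B₂ * C₂ * C₂
     + (AG Q₁ A₁ B₁ V₁ T₁) * Q₁ * B₂ * C₂ * W₂ + 2 * (AG Q₁ A₁ B₁ V₁ T₁) * Q₁ * B₂ * C₂ * Q₂ + (AG Q₁ A₁ B₁ V₁ T₁) * Q₁ * B₂ * W₂ * Q₂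
     + (AG Q₁ A₁ B₁ V₁ T₁) * Q₁ * B₂ * Q₂ * Q₂ + (Hb Q₁ A₁ B₁ V₁ T₁) * T₂ * B₂ * B₂ + (Hb Q₁ A₁ B₁ V₁ T₁) * B₂ * B₂ * B₂
     + (Hb Q₁ A₁ B₁ V₁ T₁) * B₂ * B₂ * C₂ + (Hb Q₁ A₁ B₁ V₁ T₁) * B₂ * B₂ * W₂ + (Hb Q₁ A₁ B₁ V₁ T₁) * B₂ * B₂ * Q₂
     + (Q₁ - T₁) * A₁ * B₁ * T₂ * B₂ * C₂ + (Q₁ - T₁) * A₁ * B₁ * T₂ * B₂ * Q₂ + (Q₁ - T₁) * A₁ * B₁ * B₂ * B₂ * C₂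
     + (Q₁ - T₁) * A₁ * B₁ * B₂ * B₂ * Q₂ + (Q₁ - T₁) * B₁ * Q₁ * B₂ * B₂ * C₂ + (Q₁ - T₁) * B₁ * Q₁ * B₂ * C₂ * Q₂ := by
  simp only [Hb, AG]; ring

/-- **`Ha` under the 2-sum of two DENSE-type laws** (identity, any commutative ring; 88 generator products, kit j112721): every summand is a
product of cells, `AG₁`, `AG₂`, `Ha₁`, `Ha₂` and the dense-regime margins `T₁ − Q₁`, `T₂ − Q₂`. [this work] -/
theorem Ha_twoSum_dense (T₁ A₁ B₁ V₁ Q₁ T₂ B₂ C₂ W₂ Q₂ : R) :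
    Ha (A₁ * C₂ + A₁ * Q₂ + B₁ * Q₂ + Q₁ * (B₂ + C₂ + Q₂))
      (T₁ * C₂ + T₁ * Q₂ + V₁ * (B₂ + C₂ + Q₂) + B₁ * C₂) (B₁ * B₂)
      (A₁ * (T₂ + W₂ + B₂) + B₁ * W₂ + Q₁ * (T₂ + W₂)) ((T₁ + V₁) * (T₂ + W₂) + T₁ * B₂ + B₁ * T₂)
    = T₁ * T₁ * B₁ * B₂ * W₂ * W₂ + T₁ * T₁ * B₁ * (AG Q₂ B₂ C₂ W₂ T₂) * T₂ + T₁ * T₁ * B₁ * (AG Q₂ B₂ C₂ W₂ T₂) * B₂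
     + T₁ * T₁ * B₁ * (AG Q₂ B₂ C₂ W₂ T₂) * W₂ + T₁ * A₁ * B₁ * T₂ * B₂ * W₂ + T₁ * A₁ * B₁ * B₂ * B₂ * W₂ + T₁ * A₁ * B₁ * B₂ * W₂ * W₂
     + T₁ * A₁ * B₁ * (AG Q₂ B₂ C₂ W₂ T₂) * T₂ + T₁ * A₁ * B₁ * (AG Q₂ B₂ C₂ W₂ T₂) * B₂ + T₁ * A₁ * B₁ * (AG Q₂ B₂ C₂ W₂ T₂) * W₂
     + T₁ * B₁ * B₁ * (AG Q₂ B₂ C₂ W₂ T₂) * T₂ + T₁ * B₁ * B₁ * (AG Q₂ B₂ C₂ W₂ T₂) * B₂ + T₁ * B₁ * B₁ * (AG Q₂ B₂ C₂ W₂ T₂) * W₂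
     + T₁ * B₁ * B₁ * (Ha Q₂ B₂ C₂ W₂ T₂) + T₁ * B₁ * B₁ * (T₂ - Q₂) * B₂ * W₂ + T₁ * B₁ * V₁ * T₂ * B₂ * C₂ + 2 * T₁ * B₁ * V₁ * T₂ * B₂ * W₂
     + T₁ * B₁ * V₁ * B₂ * B₂ * C₂ + T₁ * B₁ * V₁ * B₂ * C₂ * W₂ + 2 * T₁ * B₁ * V₁ * B₂ * W₂ * W₂ + 2 * T₁ * B₁ * V₁ * (AG Q₂ B₂ C₂ W₂ T₂) * T₂
     + T₁ * B₁ * V₁ * (AG Q₂ B₂ C₂ W₂ T₂) * B₂ + 2 * T₁ * B₁ * V₁ * (AG Q₂ B₂ C₂ W₂ T₂) * W₂ + T₁ * B₁ * V₁ * (T₂ - Q₂) * B₂ * W₂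
     + T₁ * B₁ * Q₁ * (AG Q₂ B₂ C₂ W₂ T₂) * T₂ + T₁ * B₁ * Q₁ * (AG Q₂ B₂ C₂ W₂ T₂) * B₂ + T₁ * B₁ * Q₁ * (AG Q₂ B₂ C₂ W₂ T₂) * W₂
     + T₁ * B₁ * Q₁ * (T₂ - Q₂) * B₂ * W₂ + A₁ * B₁ * B₁ * T₂ * B₂ * W₂ + A₁ * B₁ * B₁ * B₂ * B₂ * W₂ + A₁ * B₁ * B₁ * (Ha Q₂ B₂ C₂ W₂ T₂)
     + A₁ * B₁ * V₁ * T₂ * B₂ * W₂ + A₁ * B₁ * V₁ * B₂ * W₂ * W₂ + A₁ * B₁ * V₁ * (AG Q₂ B₂ C₂ W₂ T₂) * T₂ + A₁ * B₁ * V₁ * (AG Q₂ B₂ C₂ W₂ T₂) * W₂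
     + B₁ * B₁ * B₁ * (Ha Q₂ B₂ C₂ W₂ T₂) + B₁ * B₁ * V₁ * T₂ * B₂ * C₂ + B₁ * B₁ * V₁ * B₂ * B₂ * C₂ + B₁ * B₁ * V₁ * (AG Q₂ B₂ C₂ W₂ T₂) * T₂
     + B₁ * B₁ * V₁ * (AG Q₂ B₂ C₂ W₂ T₂) * W₂ + B₁ * B₁ * V₁ * (Ha Q₂ B₂ C₂ W₂ T₂) + B₁ * B₁ * V₁ * (T₂ - Q₂) * T₂ * B₂
     + B₁ * B₁ * V₁ * (T₂ - Q₂) * B₂ * W₂ + B₁ * B₁ * Q₁ * (Ha Q₂ B₂ C₂ W₂ T₂) + B₁ * V₁ * V₁ * T₂ * T₂ * B₂ + B₁ * V₁ * V₁ * T₂ * B₂ * C₂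
     + 2 * B₁ * V₁ * V₁ * T₂ * B₂ * W₂ + B₁ * V₁ * V₁ * B₂ * C₂ * W₂ + B₁ * V₁ * V₁ * B₂ * W₂ * W₂ + B₁ * V₁ * V₁ * (AG Q₂ B₂ C₂ W₂ T₂) * T₂
     + B₁ * V₁ * V₁ * (AG Q₂ B₂ C₂ W₂ T₂) * W₂ + B₁ * V₁ * Q₁ * (AG Q₂ B₂ C₂ W₂ T₂) * T₂ + B₁ * V₁ * Q₁ * (AG Q₂ B₂ C₂ W₂ T₂) * W₂
     + B₁ * V₁ * Q₁ * (T₂ - Q₂) * T₂ * B₂ + (AG Q₁ A₁ B₁ V₁ T₁) * T₁ * T₂ * T₂ * B₂ + (AG Q₁ A₁ B₁ V₁ T₁) * T₁ * T₂ * B₂ * B₂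
     + (AG Q₁ A₁ B₁ V₁ T₁) * T₁ * T₂ * B₂ * C₂ + 2 * (AG Q₁ A₁ B₁ V₁ T₁) * T₁ * T₂ * B₂ * W₂ + (AG Q₁ A₁ B₁ V₁ T₁) * T₁ * B₂ * B₂ * C₂
     + 2 * (AG Q₁ A₁ B₁ V₁ T₁) * T₁ * B₂ * B₂ * W₂ + (AG Q₁ A₁ B₁ V₁ T₁) * T₁ * B₂ * C₂ * W₂ + (AG Q₁ A₁ B₁ V₁ T₁) * T₁ * B₂ * W₂ * W₂
     + (AG Q₁ A₁ B₁ V₁ T₁) * T₁ * B₂ * W₂ * Q₂ + (AG Q₁ A₁ B₁ V₁ T₁) * B₁ * T₂ * T₂ * B₂ + (AG Q₁ A₁ B₁ V₁ T₁) * B₁ * T₂ * B₂ * B₂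
     + (AG Q₁ A₁ B₁ V₁ T₁) * B₁ * T₂ * B₂ * C₂ + (AG Q₁ A₁ B₁ V₁ T₁) * B₁ * T₂ * B₂ * W₂ + (AG Q₁ A₁ B₁ V₁ T₁) * B₁ * B₂ * B₂ * C₂
     + (AG Q₁ A₁ B₁ V₁ T₁) * B₁ * B₂ * B₂ * W₂ + (AG Q₁ A₁ B₁ V₁ T₁) * V₁ * T₂ * T₂ * B₂ + (AG Q₁ A₁ B₁ V₁ T₁) * V₁ * T₂ * B₂ * B₂
     + (AG Q₁ A₁ B₁ V₁ T₁) * V₁ * T₂ * B₂ * C₂ + 2 * (AG Q₁ A₁ B₁ V₁ T₁) * V₁ * T₂ * B₂ * W₂ + (AG Q₁ A₁ B₁ V₁ T₁) * V₁ * T₂ * B₂ * Q₂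
     + (AG Q₁ A₁ B₁ V₁ T₁) * V₁ * B₂ * B₂ * W₂ + (AG Q₁ A₁ B₁ V₁ T₁) * V₁ * B₂ * C₂ * W₂ + (AG Q₁ A₁ B₁ V₁ T₁) * V₁ * B₂ * W₂ * W₂
     + (AG Q₁ A₁ B₁ V₁ T₁) * V₁ * B₂ * W₂ * Q₂ + (Ha Q₁ A₁ B₁ V₁ T₁) * T₂ * B₂ * B₂ + (Ha Q₁ A₁ B₁ V₁ T₁) * T₂ * B₂ * Q₂
     + (Ha Q₁ A₁ B₁ V₁ T₁) * B₂ * B₂ * B₂ + (Ha Q₁ A₁ B₁ V₁ T₁) * B₂ * B₂ * Q₂ + (T₁ - Q₁) * T₁ * B₁ * T₂ * B₂ * W₂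
     + (T₁ - Q₁) * T₁ * B₁ * B₂ * B₂ * W₂ + (T₁ - Q₁) * B₁ * V₁ * T₂ * T₂ * B₂ + (T₁ - Q₁) * B₁ * V₁ * T₂ * B₂ * B₂
     + (T₁ - Q₁) * B₁ * V₁ * B₂ * B₂ * W₂ + (T₁ - Q₁) * B₁ * V₁ * B₂ * W₂ * Q₂ := by
  simp only [Ha, AG]; ring

end Identities

/-! ### Signs -/

/-- `AG ≥ 0` is preserved by the 2-sum (from `AG_twoSum`). [this work] -/
theorem AG_twoSum_nonneg {T₁ A₁ B₁ V₁ Q₁ T₂ B₂ C₂ W₂ Q₂ : ℝ}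
    (hT₁ : 0 ≤ T₁) (hA₁ : 0 ≤ A₁) (hB₁ : 0 ≤ B₁) (hV₁ : 0 ≤ V₁) (hQ₁ : 0 ≤ Q₁)
    (hT₂ : 0 ≤ T₂) (hB₂ : 0 ≤ B₂) (hC₂ : 0 ≤ C₂) (hW₂ : 0 ≤ W₂) (hQ₂ : 0 ≤ Q₂)
    (hAG₁ : 0 ≤ AG Q₁ A₁ B₁ V₁ T₁) (hAG₂ : 0 ≤ AG Q₂ B₂ C₂ W₂ T₂) :
    0 ≤ AG (A₁ * C₂ + A₁ * Q₂ + B₁ * Q₂ + Q₁ * (B₂ + C₂ + Q₂))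
      (T₁ * C₂ + T₁ * Q₂ + V₁ * (B₂ + C₂ + Q₂) + B₁ * C₂) (B₁ * B₂)
      (A₁ * (T₂ + W₂ + B₂) + B₁ * W₂ + Q₁ * (T₂ + W₂)) ((T₁ + V₁) * (T₂ + W₂) + T₁ * B₂ + B₁ * T₂) := by
  rw [AG_twoSum]
  generalize AG Q₁ A₁ B₁ V₁ T₁ = G₁ at hAG₁ ⊢
  generalize AG Q₂ B₂ C₂ W₂ T₂ = G₂ at hAG₂ ⊢
  positivity

/-- **Sparse × sparse ⟹ `Hb ≥ 0`**: the sparse sheet of the sharp cubic row is closed under 2-sums (from `Hb_twoSum_sparse`). [this work] -/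
theorem Hb_twoSum_sparse_nonneg {T₁ A₁ B₁ V₁ Q₁ T₂ B₂ C₂ W₂ Q₂ : ℝ}
    (hT₁ : 0 ≤ T₁) (hA₁ : 0 ≤ A₁) (hB₁ : 0 ≤ B₁) (hV₁ : 0 ≤ V₁) (hQ₁ : 0 ≤ Q₁)
    (hT₂ : 0 ≤ T₂) (hB₂ : 0 ≤ B₂) (hC₂ : 0 ≤ C₂) (hW₂ : 0 ≤ W₂) (hQ₂ : 0 ≤ Q₂)
    (hAG₁ : 0 ≤ AG Q₁ A₁ B₁ V₁ T₁) (hAG₂ : 0 ≤ AG Q₂ B₂ C₂ W₂ T₂)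
    (hHb₁ : 0 ≤ Hb Q₁ A₁ B₁ V₁ T₁) (hHb₂ : 0 ≤ Hb Q₂ B₂ C₂ W₂ T₂) (hR₁ : T₁ ≤ Q₁) (hR₂ : T₂ ≤ Q₂) :
    0 ≤ Hb (A₁ * C₂ + A₁ * Q₂ + B₁ * Q₂ + Q₁ * (B₂ + C₂ + Q₂))
      (T₁ * C₂ + T₁ * Q₂ + V₁ * (B₂ + C₂ + Q₂) + B₁ * C₂) (B₁ * B₂)
      (A₁ * (T₂ + W₂ + B₂) + B₁ * W₂ + Q₁ * (T₂ + W₂)) ((T₁ + V₁) * (T₂ + W₂) + T₁ * B₂ + B₁ * T₂) := by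
  rw [Hb_twoSum_sparse]
  have hr₁ : 0 ≤ Q₁ - T₁ := sub_nonneg.2 hR₁
  have hr₂ : 0 ≤ Q₂ - T₂ := sub_nonneg.2 hR₂
  generalize Q₁ - T₁ = r₁ at hr₁ ⊢
  generalize Q₂ - T₂ = r₂ at hr₂ ⊢
  generalize AG Q₁ A₁ B₁ V₁ T₁ = G₁ at hAG₁ ⊢
  generalize AG Q₂ B₂ C₂ W₂ T₂ = G₂ at hAG₂ ⊢
  generalize Hb Q₁ A₁ B₁ V₁ T₁ = K₁ at hHb₁ ⊢
  generalize Hb Q₂ B₂ C₂ W₂ T₂ = K₂ at hHb₂ ⊢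
  positivity

/-- **Dense × dense ⟹ `Ha ≥ 0`**: the dense sheet is closed under 2-sums (from `Ha_twoSum_dense`). [this work] -/
theorem Ha_twoSum_dense_nonneg {T₁ A₁ B₁ V₁ Q₁ T₂ B₂ C₂ W₂ Q₂ : ℝ}
    (hT₁ : 0 ≤ T₁) (hA₁ : 0 ≤ A₁) (hB₁ : 0 ≤ B₁) (hV₁ : 0 ≤ V₁) (hQ₁ : 0 ≤ Q₁)
    (hT₂ : 0 ≤ T₂) (hB₂ : 0 ≤ B₂) (hC₂ : 0 ≤ C₂) (hW₂ : 0 ≤ W₂) (hQ₂ : 0 ≤ Q₂)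
    (hAG₁ : 0 ≤ AG Q₁ A₁ B₁ V₁ T₁) (hAG₂ : 0 ≤ AG Q₂ B₂ C₂ W₂ T₂)
    (hHa₁ : 0 ≤ Ha Q₁ A₁ B₁ V₁ T₁) (hHa₂ : 0 ≤ Ha Q₂ B₂ C₂ W₂ T₂) (hR₁ : Q₁ ≤ T₁) (hR₂ : Q₂ ≤ T₂) :
    0 ≤ Ha (A₁ * C₂ + A₁ * Q₂ + B₁ * Q₂ + Q₁ * (B₂ + C₂ + Q₂))
      (T₁ * C₂ + T₁ * Q₂ + V₁ * (B₂ + C₂ + Q₂) + B₁ * C₂) (B₁ * B₂)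
      (A₁ * (T₂ + W₂ + B₂) + B₁ * W₂ + Q₁ * (T₂ + W₂)) ((T₁ + V₁) * (T₂ + W₂) + T₁ * B₂ + B₁ * T₂) := by
  rw [Ha_twoSum_dense]
  have hr₁ : 0 ≤ T₁ - Q₁ := sub_nonneg.2 hR₁
  have hr₂ : 0 ≤ T₂ - Q₂ := sub_nonneg.2 hR₂
  generalize T₁ - Q₁ = r₁ at hr₁ ⊢
  generalize T₂ - Q₂ = r₂ at hr₂ ⊢
  generalize AG Q₁ A₁ B₁ V₁ T₁ = G₁ at hAG₁ ⊢
  generalize AG Q₂ B₂ C₂ W₂ T₂ = G₂ at hAG₂ ⊢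
  generalize Ha Q₁ A₁ B₁ V₁ T₁ = K₁ at hHa₁ ⊢
  generalize Ha Q₂ B₂ C₂ W₂ T₂ = K₂ at hHa₂ ⊢
  positivity

/-- **Same-type 2-sums preserve the K3 invariant** `{AG ≥ 0, max(Ha,Hb) ≥ 0}` (regime form: two sparse pieces give a law on the
sparse sheet, two dense pieces a law on the dense sheet). [this work] -/
theorem maxH_twoSum_sameType_nonneg {T₁ A₁ B₁ V₁ Q₁ T₂ B₂ C₂ W₂ Q₂ : ℝ}
    (hT₁ : 0 ≤ T₁) (hA₁ : 0 ≤ A₁) (hB₁ : 0 ≤ B₁) (hV₁ : 0 ≤ V₁) (hQ₁ : 0 ≤ Q₁)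
    (hT₂ : 0 ≤ T₂) (hB₂ : 0 ≤ B₂) (hC₂ : 0 ≤ C₂) (hW₂ : 0 ≤ W₂) (hQ₂ : 0 ≤ Q₂)
    (hAG₁ : 0 ≤ AG Q₁ A₁ B₁ V₁ T₁) (hAG₂ : 0 ≤ AG Q₂ B₂ C₂ W₂ T₂)
    (h : (T₁ ≤ Q₁ ∧ T₂ ≤ Q₂ ∧ 0 ≤ Hb Q₁ A₁ B₁ V₁ T₁ ∧ 0 ≤ Hb Q₂ B₂ C₂ W₂ T₂) ∨
         (Q₁ ≤ T₁ ∧ Q₂ ≤ T₂ ∧ 0 ≤ Ha Q₁ A₁ B₁ V₁ T₁ ∧ 0 ≤ Ha Q₂ B₂ C₂ W₂ T₂)) :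
    0 ≤ max (Ha (A₁ * C₂ + A₁ * Q₂ + B₁ * Q₂ + Q₁ * (B₂ + C₂ + Q₂))
      (T₁ * C₂ + T₁ * Q₂ + V₁ * (B₂ + C₂ + Q₂) + B₁ * C₂) (B₁ * B₂)
      (A₁ * (T₂ + W₂ + B₂) + B₁ * W₂ + Q₁ * (T₂ + W₂)) ((T₁ + V₁) * (T₂ + W₂) + T₁ * B₂ + B₁ * T₂))
      (Hb (A₁ * C₂ + A₁ * Q₂ + B₁ * Q₂ + Q₁ * (B₂ + C₂ + Q₂))
      (T₁ * C₂ + T₁ * Q₂ + V₁ * (B₂ + C₂ + Q₂) + B₁ * C₂) (B₁ * B₂)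
      (A₁ * (T₂ + W₂ + B₂) + B₁ * W₂ + Q₁ * (T₂ + W₂)) ((T₁ + V₁) * (T₂ + W₂) + T₁ * B₂ + B₁ * T₂)) := by
  rcases h with ⟨h1, h2, h3, h4⟩ | ⟨h1, h2, h3, h4⟩
  · exact le_max_of_le_right (Hb_twoSum_sparse_nonneg hT₁ hA₁ hB₁ hV₁ hQ₁ hT₂ hB₂ hC₂ hW₂ hQ₂ hAG₁ hAG₂ h3 h4 h1 h2)
  · exact le_max_of_le_left (Ha_twoSum_dense_nonneg hT₁ hA₁ hB₁ hV₁ hQ₁ hT₂ hB₂ hC₂ hW₂ hQ₂ hAG₁ hAG₂ h3 h4 h1 h2)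

end CubicThreePointTwoSum

end Summit.CriticalPhenomena.PercolationContinuityZ3.Theorems
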